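import Summits.Ventures.HSemireg.WedgeWeilPieces

/-!
# Venture HSemireg — THEOREM R-B in the wedge model (5/9)

HONEST FRAMING. Part of the Lean index of the computation cell `pub-hsemireg` (seat p3; Sunday enclosure of the
FORMULA-N kernel assets of seats th-7 / th-6, ENCLOSURE-PLAN-p3.md).  Finite-dimensional exterior algebra over a field ONLY:
no variety, no cohomology theory, no semiregularity map is constructed here; nothing here says that HC / HC_CM / HC_AV holds;
no Literature fact is declared or used.  The geometric DICTIONARY (why these ranks are the `HT`-side box ranks of the cell's
STRUCTURE.md §1 / theory/FORMULA-N.md) lives in theory/FORMULA-N-th7.md PART B §A.3 / §N and is NOT asserted in Lean.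

THEOREM R-B (FORMULA-N PART B §L.3 / §L.8; STRUCTURE D9, (F1) Weil-frame clause, C16) in the SIGN-FREE transposed wedge model — theory/th7/WeilRank.lean v3 sha256/16 7e5d6bad1a94e25a (th-7 g4, 18:46Z; ×2 farm th-2 g20 18:48:20Z); PART R/R2/R3 = l.1506–3436 on top of HankelRank v1 (= the tree's Wedge/WedgeHankel* files), VERBATIM up
to namespaces (`HSemiregWeil` ↦ `Summit.Ventures.HSemireg.Wedge.Weil`, which sees the wedge-model infrastructure `….Wedge` and opens `….Wedge.Hankel`), file 5 of 9.
MODEL: `N` pairs of generators `x_c`, `y_c`; the h-part `f = w_N(q)` (HankelRank); the «Weil vectors» `w₊ = E_{G₋}`, `w₋ = E_{G₊}` = the full monomials on the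
generator blocks of the last `N − p` / first `p` pairs (signature `(p, N − p)`; THEOREM R is `N = 2n`, `p = n`).  HEADLINES (files 5, 8, 9): `weilRank` /
`weilRank_nn` («rank(⌟v ∣ HT²) = (4 + ρ)·n² − 2n», `v = f + a w₊ + b w₋`, `ab ≠ 0`, `n ≥ 3`, ρ = rank H₂(q)), `ker_eq` (kernel = mixed 2-forms killing `f`),
`weilRank_deg` / `weilRank_nn_deg` (every degree `m`, `m + 1 ≤ N − p`), `weilRank_one` / `weilRank_nn_one` (one-sided, ε = 1).  No permutation sign is evaluated
(the pair symmetries act through `AlternatingMap.map_perm`; `sgn κ` is a unit).  This file: ASSEMBLY in degree 2 — `finrank_map_f_Pset` (every pair piece of `Λ² ∧ f` has rank ρ), the mixed-pair count `card_MX = p (N − p)`, `finrank_map_f_M`, **`weilRank`** (signature `(p, N − p)`, `N − p ≥ 3`) and **`weilRank_nn`** (THEOREM R: `finrank + 2n = 4n² + n²·ρ`).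
-/

open Module Set Set.powersetCard Summit.Ventures.HSemireg.Wedge.Hankel

namespace Summit.Ventures.HSemireg.Wedge.Weil

variable (K : Type*) [Field K]

/-! ### Decompositions, counts, and the assembly of THEOREM R-B -/

section Assembly

variable {N : ℕ}

/-- **total decomposition:** `(Λ²N) ∧ f = Σ_{|s| = 2} (Pset s) ∧ f` (the diagonal products die). -/
lemma map_f_Hom_eq (q : ℕ → K) :
    (Hom K (In N) Finset.univ 2).map (LinearMap.mulRight K (w K N N q)) =
      ⨆ s ∈ (Finset.univ : Finset (Fin N)).powersetCard 2, (Pset K N s).map (LinearMap.mulRight K (w K N N q)) := by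
  classical
  apply le_antisymm
  · rw [Submodule.map_le_iff_le_comap, Hom]
    apply Submodule.span_le.mpr
    rintro _ ⟨t, ⟨-, ht⟩, rfl⟩
    rw [SetLike.mem_coe, Submodule.mem_comap, LinearMap.mulRight_apply]
    dsimp only
    obtain ⟨i, j, hij, rfl⟩ := Finset.card_eq_two.mp ht
    by_cases hpr : pr i = pr j
    · have hj : j = pt i := (eq_or_eq_pt_of_pr_eq hpr).resolve_left hij.symm
      subst hj
      rw [B_pair_eq K hij, smul_mul_assoc, gx_mul_pt_mul_f, smul_zero]
      exact Submodule.zero_mem _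
    · rw [B_pair_eq K hij, smul_mul_assoc]
      refine Submodule.smul_mem _ _ ?_
      have hs : ({pr i, pr j} : Finset (Fin N)) ∈ (Finset.univ : Finset (Fin N)).powersetCard 2 := by
        rw [Finset.mem_powersetCard_univ, Finset.card_pair hpr]
      have hmem : gx K i * gx K j * w K N N q ∈ (Pset K N {pr i, pr j}).map (LinearMap.mulRight K (w K N N q)) :=
        Submodule.mem_map_of_mem (gx_mul_gx_mem_Pset K (by simp) (by simp) hpr)
      exact le_biSup (fun s => (Pset K N s).map (LinearMap.mulRight K (w K N N q))) hs hmem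
  · exact iSup₂_le fun s _ => Submodule.map_mono (Pset_le_Hom K s)

/-- **every piece has rank ρ = rank H₂(q)** (symmetry + THEOREM H in degree 2). -/
theorem finrank_map_f_Pset {s₀ : Finset (Fin N)} (hs₀ : s₀.card = 2) (q : ℕ → K) :
    Module.finrank K ↥((Pset K N s₀).map (LinearMap.mulRight K (w K N N q))) = (hankel1 K N 2 q).rank := by
  classical
  have htot : Module.finrank K ↥((Hom K (In N) Finset.univ 2).map (LinearMap.mulRight K (w K N N q))) =
      N.choose 2 * (hankel1 K N 2 q).rank := by
    rw [← range_wedge]; exact hankelLaw_model K 2 q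
  rw [map_f_Hom_eq,
    finrank_biSup_eq_sum _ _ (fun s => Qpred N s)
      (fun s hs => map_f_Pset_le K (Finset.mem_powersetCard_univ.mp hs) 0 q)
      (fun s _ s' _ hss' => Qpred_disjoint hss'),
    Finset.sum_const_nat (m := Module.finrank K ↥((Pset K N s₀).map (LinearMap.mulRight K (w K N N q))))
      (fun s hs => finrank_map_f_Pset_eq K (Finset.mem_powersetCard_univ.mp hs) hs₀ q),
    Finset.card_powersetCard, Finset.card_univ, Fintype.card_fin] at htot
  have hpos : 0 < N.choose 2 := by
    rw [← Fintype.card_fin N, ← Finset.card_univ, ← Finset.card_powersetCard]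
    exact Finset.card_pos.mpr ⟨s₀, Finset.mem_powersetCard_univ.mpr hs₀⟩
  exact Nat.eq_of_mul_eq_mul_left hpos htot

/-- counting: 2-sets meeting both parts of a disjoint pair `(A, B)` are in bijection with `A × B`. -/
lemma card_filter_pairs_meeting {α : Type*} [DecidableEq α] [Fintype α] (A B : Finset α) (hAB : Disjoint A B) :
    (Finset.univ.filter fun t : Finset α => t.card = 2 ∧ (∃ a ∈ t, a ∈ A) ∧ (∃ b ∈ t, b ∈ B)).card =
      A.card * B.card := by
  rw [← Finset.card_product]
  have himg : (Finset.univ.filter fun t : Finset α => t.card = 2 ∧ (∃ a ∈ t, a ∈ A) ∧ (∃ b ∈ t, b ∈ B)) =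
      (A ×ˢ B).image (fun ab => {ab.1, ab.2}) := by
    ext t
    simp only [Finset.mem_filter, Finset.mem_univ, true_and, Finset.mem_image, Finset.mem_product, Prod.exists]
    constructor
    · rintro ⟨ht, ⟨a, hat, haA⟩, ⟨b, hbt, hbB⟩⟩
      refine ⟨a, b, ⟨haA, hbB⟩, ?_⟩
      have hab : a ≠ b := fun e => Finset.disjoint_left.mp hAB haA (e ▸ hbB)
      apply Finset.eq_of_subset_of_card_le
      · intro x hx
        rcases Finset.mem_insert.mp hx with hx | hx
        · exact hx ▸ hat
        · rw [Finset.mem_singleton] at hx; exact hx ▸ hbt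
      · rw [ht, Finset.card_pair hab]
    · rintro ⟨a, b, ⟨haA, hbB⟩, rfl⟩
      have hab : a ≠ b := fun e => Finset.disjoint_left.mp hAB haA (e ▸ hbB)
      exact ⟨Finset.card_pair hab, ⟨a, by simp, haA⟩, ⟨b, by simp, hbB⟩⟩
  rw [himg, Finset.card_image_of_injOn]
  rintro ⟨a, b⟩ hab ⟨a', b'⟩ hab' h
  rw [Finset.coe_product, Set.mem_prod, Finset.mem_coe, Finset.mem_coe] at hab hab'
  dsimp only at h hab hab'
  have ha : a ∈ ({a', b'} : Finset α) := by rw [← h]; exact Finset.mem_insert_self a {b}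
  have hb : b ∈ ({a', b'} : Finset α) := by rw [← h]; exact Finset.mem_insert_of_mem (Finset.mem_singleton_self b)
  rw [Finset.mem_insert, Finset.mem_singleton] at ha hb
  have e1 : a = a' := ha.resolve_right fun e => Finset.disjoint_left.mp hAB hab.1 (e ▸ hab'.2)
  have e2 : b = b' := hb.resolve_left fun e => Finset.disjoint_left.mp hAB (e ▸ hab'.1) hab.2
  rw [e1, e2]

/-- `dim Λ²N = C(2N, 2)`. -/
lemma finrank_Hom_univ_two : Module.finrank K ↥(Hom K (In N) Finset.univ 2) = (N + N).choose 2 := by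
  classical
  rw [Hom_univ_two, finrank_Sp]
  have h : (Finset.univ.filter (Deg2 N)) = (Finset.univ : Finset (In N)).powersetCard 2 := by
    ext t; simp [Deg2]
  rw [h, Finset.card_powersetCard, Finset.card_univ, Fintype.card_fin]

/-- `dim M = |G₊|·|G₋| = 2p · 2(N−p)`. -/
lemma finrank_M {p : ℕ} (hp : p ≤ N) : Module.finrank K ↥(M K N p) = (p + p) * ((N + N) - (p + p)) := by
  classical
  have hcount := card_filter_pairs_meeting (Dm N p) (Gm N p) (disjoint_Dm_Gm (N := N) p)
  rw [card_Dm hp, card_Gm hp] at hcount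
  rw [M, finrank_Sp, ← hcount]
  congr 1
  ext t
  simp only [Finset.mem_filter, Finset.mem_univ, true_and, Mix]
  constructor
  · rintro ⟨h1, h2, h3⟩
    obtain ⟨a, hat, ha⟩ := Finset.not_subset.mp h3
    obtain ⟨b, hbt, hb⟩ := Finset.not_subset.mp h2
    exact ⟨h1, ⟨a, hat, mem_Dm_of_not_mem_Gm ha⟩, ⟨b, hbt, mem_Gm_of_not_mem_Dm hb⟩⟩
  · rintro ⟨h1, ⟨a, hat, ha⟩, ⟨b, hbt, hb⟩⟩
    refine ⟨h1, fun h => ?_, fun h => ?_⟩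
    · exact Finset.disjoint_left.mp (disjoint_Dm_Gm p) (h hbt) hb
    · exact Finset.disjoint_left.mp (disjoint_Dm_Gm p) ha (h hat)

variable (N)

/-- the (+) and (−) pair indices and the mixed 2-sets of pairs. -/
def Ap (p : ℕ) : Finset (Fin N) := Finset.univ.filter fun c => (c : ℕ) < p
/-- the last `N − p` pair indices. -/
def Am (p : ℕ) : Finset (Fin N) := Finset.univ.filter fun c => p ≤ (c : ℕ)
/-- the mixed pairs `{a, b}`, `a < p ≤ b`. -/
def MX (p : ℕ) : Finset (Finset (Fin N)) :=
  Finset.univ.filter fun s => s.card = 2 ∧ (∃ a ∈ s, a ∈ Ap N p) ∧ (∃ b ∈ s, b ∈ Am N p)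

variable {N}

/-- `|Ap| = p`. -/
lemma card_Ap {p : ℕ} (hp : p ≤ N) : (Ap N p).card = p := by
  rw [Ap, ← Fintype.card_subtype]; exact Fintype.card_fin_lt_of_le hp

/-- `|Am| = N − p`. -/
lemma card_Am {p : ℕ} (hp : p ≤ N) : (Am N p).card = N - p := by
  have h := Finset.card_filter_add_card_filter_not (s := (Finset.univ : Finset (Fin N)))
    (fun c : Fin N => (c : ℕ) < p)
  rw [Finset.card_univ, Fintype.card_fin] at h
  have h2 : (Finset.univ.filter fun c : Fin N => ¬ (c : ℕ) < p) = Am N p := by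
    rw [Am]; exact Finset.filter_congr fun c _ => not_lt
  rw [h2, ← Ap, card_Ap hp] at h
  omega

/-- `Ap` and `Am` are disjoint. -/
lemma disjoint_Ap_Am (p : ℕ) : Disjoint (Ap N p) (Am N p) := by
  rw [Finset.disjoint_left]
  intro c h1 h2
  rw [Ap, Finset.mem_filter] at h1
  rw [Am, Finset.mem_filter] at h2
  omega

/-- `|MX| = p (N − p)`. -/
lemma card_MX {p : ℕ} (hp : p ≤ N) : (MX N p).card = p * (N - p) := by
  classical
  have h := card_filter_pairs_meeting (Ap N p) (Am N p) (disjoint_Ap_Am (N := N) p)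
  rw [card_Ap hp, card_Am hp] at h
  rw [MX]
  convert h using 2
  ext s
  simp only [Finset.mem_filter]

/-- membership in `Ap`: index `< p`. -/
lemma mem_Ap {p : ℕ} {c : Fin N} : c ∈ Ap N p ↔ (c : ℕ) < p := by simp [Ap]
/-- membership in `Am`: index `≥ p`. -/
lemma mem_Am {p : ℕ} {c : Fin N} : c ∈ Am N p ↔ p ≤ (c : ℕ) := by simp [Am]

/-- **mixed decomposition:** `M = Σ_{s ∈ MX} Pset s`. -/
lemma M_eq_iSup (p : ℕ) : M K N p = ⨆ s ∈ MX N p, Pset K N s := by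
  classical
  apply le_antisymm
  · rw [M, Sp]
    apply Submodule.span_le.mpr
    rintro _ ⟨t, ⟨ht, h2, h3⟩, rfl⟩
    obtain ⟨i, hit, hi⟩ := Finset.not_subset.mp h3
    obtain ⟨j, hjt, hj⟩ := Finset.not_subset.mp h2
    have hi' : i ∈ Dm N p := mem_Dm_of_not_mem_Gm hi
    have hj' : j ∈ Gm N p := mem_Gm_of_not_mem_Dm hj
    have hij : i ≠ j := fun e => Finset.disjoint_left.mp (disjoint_Dm_Gm p) hi' (e ▸ hj')
    have hteq : t = {i, j} := by
      symm
      apply Finset.eq_of_subset_of_card_le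
      · intro x hx
        rcases Finset.mem_insert.mp hx with hx | hx
        · exact hx ▸ hit
        · rw [Finset.mem_singleton] at hx; exact hx ▸ hjt
      · rw [ht, Finset.card_pair hij]
    rw [mem_Dm_iff] at hi'
    rw [mem_Gm_iff] at hj'
    have hpr : pr i ≠ pr j := fun e => by rw [e] at hi'; omega
    have hs : ({pr i, pr j} : Finset (Fin N)) ∈ MX N p := by
      rw [MX, Finset.mem_filter]
      exact ⟨Finset.mem_univ _, Finset.card_pair hpr, ⟨pr i, by simp, mem_Ap.mpr hi'⟩, ⟨pr j, by simp, mem_Am.mpr hj'⟩⟩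
    rw [SetLike.mem_coe]
    dsimp only
    rw [hteq, B_pair_eq K hij]
    exact Submodule.smul_mem _ _
      (le_biSup (fun s => Pset K N s) hs (gx_mul_gx_mem_Pset K (by simp) (by simp) hpr))
  · refine iSup₂_le fun s hs => ?_
    rw [MX, Finset.mem_filter] at hs
    obtain ⟨-, hs2, ⟨a, has, ha⟩, ⟨c, hcs, hc⟩⟩ := hs
    rw [mem_Ap] at ha
    rw [mem_Am] at hc
    apply Submodule.span_le.mpr
    rintro _ ⟨i, j, hi, hj, hij, rfl⟩
    have hne : i ≠ j := ne_of_pr_ne hij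
    -- {pr i, pr j} = s ∋ a, c
    have e : ({pr i, pr j} : Finset (Fin N)) = s := by
      apply Finset.eq_of_subset_of_card_le
      · intro x hx
        rcases Finset.mem_insert.mp hx with hx | hx
        · exact hx ▸ hi
        · rw [Finset.mem_singleton] at hx; exact hx ▸ hj
      · rw [hs2, Finset.card_pair hij]
    have ha' : a = pr i ∨ a = pr j := by rw [← e] at has; simpa using has
    have hc' : c = pr i ∨ c = pr j := by rw [← e] at hcs; simpa using hcs
    have key : Mix N p {i, j} := by
      refine ⟨Finset.card_pair hne, fun h => ?_, fun h => ?_⟩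
      · -- both in Dm: contradicts c
        have h1 : ((pr i : Fin N) : ℕ) < p := (mem_Dm_iff i).mp (h (by simp))
        have h2 : ((pr j : Fin N) : ℕ) < p := (mem_Dm_iff j).mp (h (by simp))
        rcases hc' with e' | e' <;> rw [e'] at hc <;> omega
      · have h1 : p ≤ ((pr i : Fin N) : ℕ) := (mem_Gm_iff i).mp (h (by simp))
        have h2 : p ≤ ((pr j : Fin N) : ℕ) := (mem_Gm_iff j).mp (h (by simp))
        rcases ha' with e' | e' <;> rw [e'] at ha <;> omega
    rw [SetLike.mem_coe, gx_mul_gx]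
    exact Submodule.smul_mem _ _ (B_mem_Sp key)

/-- `dim (M ∧ f) = p (N − p) · rank H₂(q)`. -/
lemma finrank_map_f_M {p : ℕ} (hp : p ≤ N) (q : ℕ → K) :
    Module.finrank K ↥((M K N p).map (LinearMap.mulRight K (w K N N q))) = p * (N - p) * (hankel1 K N 2 q).rank := by
  classical
  have hMX : ∀ s ∈ MX N p, s.card = 2 := fun s hs => by
    rw [MX, Finset.mem_filter] at hs; exact hs.2.1
  have e : (⨆ s ∈ MX N p, Pset K N s).map (LinearMap.mulRight K (w K N N q)) =
      ⨆ s ∈ MX N p, (Pset K N s).map (LinearMap.mulRight K (w K N N q)) := by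
    simp only [Submodule.map_iSup]
  rw [M_eq_iSup K p, e]
  rw [finrank_biSup_eq_sum _ _ (fun s => Qpred N s) (fun s hs => map_f_Pset_le K (hMX s hs) 0 q)
      (fun s _ s' _ hss' => Qpred_disjoint hss'),
    Finset.sum_const_nat (m := (hankel1 K N 2 q).rank) (fun s hs => finrank_map_f_Pset K (hMX s hs) q),
    card_MX hp]

/-- rank–nullity for a restricted map, in the form used below. -/
lemma finrank_eq_map_add_inf_ker {V : Type*} [AddCommGroup V] [Module K V] [FiniteDimensional K V]
    (U : Submodule K V) (g : V →ₗ[K] V) :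
    Module.finrank K U = Module.finrank K ↥(U.map g) + Module.finrank K ↥(U ⊓ LinearMap.ker g) := by
  have h := LinearMap.finrank_range_add_finrank_ker (g.domRestrict U)
  rw [LinearMap.range_domRestrict, LinearMap.ker_domRestrict, ← Submodule.finrank_map_subtype_eq U,
    Submodule.map_comap_subtype] at h
  exact h.symm

/-- **THEOREM R-B (signature (p, N−p), sign-free wedge model; FORMULA-N PART B §L.3).**
For `N − p ≥ 3`, `a b ≠ 0` and ANY coefficient sequence `q` (Hankel rank `ρ = rank H₂(q) ∈ {0,1,2,3}`):
`dim range(θ ↦ θ ∧ (f + a·w₊ + b·w₋) on Λ²N) = C(2N,2) − (4 − ρ)·p(N−p)`, stated additively. -/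
theorem weilRank {p : ℕ} (hNp : 3 ≤ N - p) (q : ℕ → K) {a b : K} (ha : a ≠ 0) (hb : b ≠ 0) :
    Module.finrank K (LinearMap.range (wedge K N 2 (vW K N p q a b))) + (p + p) * ((N + N) - (p + p)) =
      (N + N).choose 2 + p * (N - p) * (hankel1 K N 2 q).rank := by
  have hp : p ≤ N := by omega
  have H1 := finrank_eq_map_add_inf_ker K (Hom K (In N) Finset.univ 2) (LinearMap.mulRight K (vW K N p q a b))
  have H2 := finrank_eq_map_add_inf_ker K (M K N p) (LinearMap.mulRight K (w K N N q))
  rw [ker_eq K hNp q ha hb, finrank_Hom_univ_two, ← range_wedge] at H1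
  rw [finrank_M K hp, finrank_map_f_M K hp] at H2
  omega

/-- **THEOREM R (Weil type, signature (n,n), n ≥ 3; STRUCTURE D9 / FORMULA-N (F1)):**
`rank(⌟v ∣ HT²) = (4 + ρ)·n² − 2n` for `v = f(h) + a·w₊ + b·w₋`, `ab ≠ 0`, `ρ` = Hankel rank of `f` — here as
`finrank + 2n = 4n² + n²ρ`. -/
theorem weilRank_nn {n : ℕ} (hn : 3 ≤ n) (q : ℕ → K) {a b : K} (ha : a ≠ 0) (hb : b ≠ 0) :
    Module.finrank K (LinearMap.range (wedge K (n + n) 2 (vW K (n + n) n q a b))) + 2 * n =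
      4 * (n * n) + n * n * (hankel1 K (n + n) 2 q).rank := by
  have h := weilRank K (N := n + n) (p := n) (by omega) q ha hb
  have hnn : n ≤ n * n := Nat.le_mul_self n
  have hc : (n + n + (n + n)).choose 2 + (n + n) = 8 * (n * n) := by
    have h1 := Nat.choose_two_right (n + n + (n + n))
    have h2 : (n + n + (n + n)) * (n + n + (n + n) - 1) = 16 * (n * n) - (n + n + (n + n)) := by
      rw [Nat.mul_sub_one]; ring_nf
    rw [h2] at h1
    omega
  rw [Nat.add_sub_cancel_left, Nat.add_sub_cancel_left] at h
  have h3 : (n + n) * (n + n) = 4 * (n * n) := by ring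
  rw [h3] at h
  omega

end Assembly

end Summit.Ventures.HSemireg.Wedge.Weil
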